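import Literature.NumberTheory.GaloisRepresentations.LubinTateColemanRelativeInterpolationTwo
import HarnessLib

set_option autoImplicit false

/-!
# LOCAL-UNTWIST₂ (R217): the untwisting automorphism `σ_loc(K, v) = σ₀^K| ∘ σ_{χ_π(σ₀^K)⁻¹ v}` of `E·K_π^{m+1}`
# EXISTS, is UNIQUE, and reads the Frobenius-twisted value tables as Galois conjugates

Cell `bsd-print-cf2`, typer `bsd-print-cf2-ty2` g45 (literature-prover seat; typer directory `Rank1Residual/P2/`, Theses-free, no
item): port P52 of STUB-PLAN `stub_heegnerIndexLowerAtTwo` (crux `PrintCf2.SplitBadTwoLowerHalfOfFacts`, stmt-BirchSwinnertonDyer-27851;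
CRITIC-ROWS-g42 rows; sketches k3-g40 `2333f3139e2b61f4` §4 and k3-g41 `dd11a8b2fa6fa744` §0–§6, critic g42 J4/J5/B68).  HONEST FRAMING:
nothing here proves BSD, the crux or the stub; no named fact, no `sorry`.  `ActsAsFrobPow` / `LocalUntwistExists` are k3-g40's
`Prop`-valued receptacles (explicit binders); the node `LocalUntwistExists` (R217∃) is PROVED here (`localUntwistExists`), so k3-g40's
`exists_untwisted_table` is ported HYPOTHESIS-FREE (critic J4) and with the EXPLICIT untwist (J5).  k3-g41's sub-stub wrappers
U1/U2/U3 are inlined: U1 = tree `mapPt_relRestrict_relAct`, U2 = tree `relGalOfUnit_apply_inclusion` / `mapPt_relGalOfUnit_relAct`,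
U3 = `actsAsFrobPow_relRestrict` below.

* §1 the node: `ActsAsFrobPow`, `LocalUntwistExists` (k3-g40 §4 verbatim).
* §2 `φ^[K] = σ₀^K|` on `𝒪_E`: `coe_frobUnitBall_apply`, `coe_frobUnitBall_iterate`, `actsAsFrobPow_relRestrict`, `inclPt_cohPt_eq_relAct`.
* §3 the explicit untwist: `localUntwist`, `localUntwist_actsAsFrobPow`, `mapPt_localUntwist_relAct`, `mapPt_localUntwist_cohPt`,
  ★ `localUntwistExists`, `localUntwistExists_offset`.
* §4 uniqueness: `forall_apply_inclusion_of_forall_unitBall`, ★ `localUntwist_unique`, `eq_localUntwist`, `localUntwist_add_mul`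
  (`σ_loc` is a homomorphic image of `ℕ × 𝒪_F^×` — de Shalit I §1.8 in Galois form, relative to `E`), `actsAsFrobPow_zero_relGalOfUnit`,
  `localUntwist_zero`; degenerate instance `E = ⊥` (B68): `frobUnitBall_iterate_bot`, `actsAsFrobPow_bot`, `localUntwist_bot`.
* §5 value half (`evS` is Frobenius-semilinear): `coeff_map_iterate`, ★ `evS_mapPt_eq_of_actsAsFrobPow`, `exists_untwisted_table`
  (hex-free), ★ `untwisted_table_explicit`.

References: [deShalit1987] I §1.5, §1.8 (the Galois group of `F(E[𝔣p^∞])`, `Gal ⊇ ⟨φ⟩ × 𝒪^×`), I.3.3 (7)–(8) (p. 17), I.3.7;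
[LubinTate1965] Thm 3, (16)–(18).
-/

noncomputable section

namespace Summit.BirchSwinnertonDyer.Rank1Residual.P2.LocalUntwist

open ValuativeRel IsLocalRing Field
open Literature.NumberTheory.GaloisRepresentations Literature.NumberTheory.GaloisRepresentations.IsNonarchimedeanLocalField
  Literature.NumberTheory.GaloisRepresentations.LubinTate Literature.NumberTheory.PAdicHodge

variable {F : Type} [Field F] [ValuativeRel F] [TopologicalSpace F] [IsNonarchimedeanLocalField F]

attribute [local instance] ltNormUniformSpace ltNormIsUniformAddGroup rk1 nF nE fintypeResidueField

variable {π : 𝒪[F]} (hπ : (valuation F).IsUniformizer (π : F))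
variable (E : IntermediateField F (AlgebraicClosure F)) [FiniteDimensional F E] [Normal F E]

/-! ## §1. The node (k3-g40 §4): `ActsAsFrobPow`, `LocalUntwistExists` -/

/-- "`τ ∈ Aut_F(E·K_π^{m+1})` acts on `𝒪_E` as `φ^K`" (`φ = frobUnitBall E σ₀`; `K` is NOT tied to the level). -/
def ActsAsFrobPow (σ₀ : absoluteGaloisGroup F) (K : ℕ) {m : ℕ}
    (τ : (E ⊔ ltField π m : IntermediateField F (AlgebraicClosure F)) ≃ₐ[F]
      (E ⊔ ltField π m : IntermediateField F (AlgebraicClosure F))) : Prop :=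
  ∀ x : unitBall E, τ (IntermediateField.inclusion le_sup_left (x : E)) =
    IntermediateField.inclusion le_sup_left
      (((((frobUnitBall E σ₀ : unitBall E ≃+* unitBall E) : unitBall E →+* unitBall E) :
        unitBall E → unitBall E)^[K] x : unitBall E) : E)

/-- R217 EXISTENCE HALF (k3-g40's typed sub-stub): for every level `m`, exponent `K` and unit `v` there is
`τ ∈ Aut_F(E·K_π^{m+1})` acting on `𝒪_E` as `φ^K` and moving `ι ω_{m+1}` as `σ_v` does. -/
def LocalUntwistExists (hE : E ≤ maxUnramified F) (σ₀ : absoluteGaloisGroup F) : Prop :=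
  ∀ (m K : ℕ) (v : 𝒪[F]ˣ), ∃ τ : (E ⊔ ltField π m : IntermediateField F (AlgebraicClosure F)) ≃ₐ[F]
      (E ⊔ ltField π m : IntermediateField F (AlgebraicClosure F)),
    ActsAsFrobPow E σ₀ K τ ∧
      mapPt τ (inclPt (le_sup_right : ltField π m ≤ E ⊔ ltField π m) (cohPt hπ m)) =
        mapPt (relGalOfUnit hπ E m hE v) (inclPt (le_sup_right : ltField π m ≤ E ⊔ ltField π m) (cohPt hπ m))

/-! ## §2. `φ^[K] = σ₀^K|` on `𝒪_E` (k3-g41 §3, U3) and `ι ω_{m+1} = [c_m]λ'` -/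

/-- `φ = σ₀|` on `𝒪_E`, read in `F̄`. -/
theorem coe_frobUnitBall_apply (σ₀ : absoluteGaloisGroup F) (x : unitBall E) :
    ((((((frobUnitBall E σ₀ : unitBall E ≃+* unitBall E) : unitBall E →+* unitBall E) :
        unitBall E → unitBall E) x : unitBall E) : E) : AlgebraicClosure F) =
      σ₀ • ((x : E) : AlgebraicClosure F) := by
  change ((((absoluteGaloisGroup.toAlgEquiv F σ₀).restrictNormal E) (x : E) : E) : AlgebraicClosure F) = _
  exact coe_restrictNormal_apply E σ₀ (x : E)

/-- `φ^[K] = σ₀^K|` on `𝒪_E`, read in `F̄`. -/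
theorem coe_frobUnitBall_iterate (σ₀ : absoluteGaloisGroup F) (K : ℕ) (x : unitBall E) :
    ((((((frobUnitBall E σ₀ : unitBall E ≃+* unitBall E) : unitBall E →+* unitBall E) :
        unitBall E → unitBall E)^[K] x : unitBall E) : E) : AlgebraicClosure F) =
      (σ₀ ^ K) • ((x : E) : AlgebraicClosure F) := by
  induction K with
  | zero => rw [Function.iterate_zero_apply, pow_zero, one_smul]
  | succ K ih => rw [Function.iterate_succ_apply', coe_frobUnitBall_apply, ih, ← mul_smul, ← pow_succ']

/-- U3: `relRestrict (σ₀^K)` acts on `𝒪_E` as `φ^K` (both sides are `σ₀^K • x` in `F̄`). -/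
theorem actsAsFrobPow_relRestrict (σ₀ : absoluteGaloisGroup F) (m K : ℕ) :
    ActsAsFrobPow E σ₀ K (relRestrict hπ E m (σ₀ ^ K)) := by
  intro x
  apply Subtype.ext
  rw [coe_relRestrict_apply, IntermediateField.coe_inclusion, IntermediateField.coe_inclusion,
    coe_frobUnitBall_iterate]

omit [Normal F E] in
/-- `ι ω_{m+1} = [c_m]λ'` (`ω_{m+1} = [c_m]λ_{m+1}`, `c_m = cohUnit`). -/
theorem inclPt_cohPt_eq_relAct (m : ℕ) :
    inclPt (le_sup_right : ltField π m ≤ E ⊔ ltField π m) (cohPt hπ m) =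
      relAct hπ E m (cohUnit hπ m : 𝒪[F]) (relGenPt hπ E m) := by
  rw [cohPt_eq]; exact inclPt_ltAct_genPt hπ E m _

/-! ## §3. The EXPLICIT untwist `σ_loc(K, v) = σ₀^K| ∘ σ_{χ_π(σ₀^K)⁻¹ v}` (k3-g41 §6) — hence R217∃ -/

/-- **The explicit local untwist** `σ_loc(K, v) := σ₀^K|_{E·K_π^{m+1}} ∘ σ_{χ_π(σ₀^K)⁻¹·v}` (`χ_π = lubinTateChar`,
the Lubin–Tate character of `Γ_F`; `σ_u = relGalOfUnit u`). -/
def localUntwist (hE : E ≤ maxUnramified F) (σ₀ : absoluteGaloisGroup F) (m K : ℕ) (v : 𝒪[F]ˣ) :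
    (E ⊔ ltField π m : IntermediateField F (AlgebraicClosure F)) ≃ₐ[F]
      (E ⊔ ltField π m : IntermediateField F (AlgebraicClosure F)) :=
  relRestrict hπ E m (σ₀ ^ K) * relGalOfUnit hπ E m hE ((lubinTateChar hπ (σ₀ ^ K))⁻¹ * v)

/-- `σ_loc(K, v)` acts on `𝒪_E` as `φ^K`. -/
theorem localUntwist_actsAsFrobPow (hE : E ≤ maxUnramified F) (σ₀ : absoluteGaloisGroup F) (m K : ℕ) (v : 𝒪[F]ˣ) :
    ActsAsFrobPow E σ₀ K (localUntwist hπ E hE σ₀ m K v) := fun x => by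
  rw [localUntwist, AlgEquiv.mul_apply, relGalOfUnit_apply_inclusion]
  exact actsAsFrobPow_relRestrict hπ E σ₀ m K x

/-- `σ_loc(K, v)([a]λ') = [v·a]λ'` — on the torsion `σ_loc(K, v)` IS `σ_v`, for every `a`. -/
theorem mapPt_localUntwist_relAct (hE : E ≤ maxUnramified F) (σ₀ : absoluteGaloisGroup F) (m K : ℕ) (v : 𝒪[F]ˣ)
    (a : 𝒪[F]) :
    mapPt (localUntwist hπ E hE σ₀ m K v) (relAct hπ E m a (relGenPt hπ E m)) =
      relAct hπ E m ((v : 𝒪[F]) * a) (relGenPt hπ E m) := by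
  rw [localUntwist, mapPt_mul, mapPt_relGalOfUnit_relAct, mapPt_relRestrict_relAct, Units.val_mul, mul_assoc,
    Units.mul_inv_cancel_left]

/-- `σ_loc(K, v)(ι ω_{m+1}) = σ_v(ι ω_{m+1})`. -/
theorem mapPt_localUntwist_cohPt (hE : E ≤ maxUnramified F) (σ₀ : absoluteGaloisGroup F) (m K : ℕ) (v : 𝒪[F]ˣ) :
    mapPt (localUntwist hπ E hE σ₀ m K v) (inclPt (le_sup_right : ltField π m ≤ E ⊔ ltField π m) (cohPt hπ m)) =
      mapPt (relGalOfUnit hπ E m hE v) (inclPt (le_sup_right : ltField π m ≤ E ⊔ ltField π m) (cohPt hπ m)) := by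
  rw [inclPt_cohPt_eq_relAct, mapPt_localUntwist_relAct, mapPt_relGalOfUnit_relAct]

/-- ★★ **`LocalUntwistExists` holds** (k3-g40's K2 = node R217∃ CLOSED): for every `m K v` the untwist exists — it is
`σ_loc(K, v)`. -/
theorem localUntwistExists (hE : E ≤ maxUnramified F) (σ₀ : absoluteGaloisGroup F) :
    LocalUntwistExists hπ E hE σ₀ := fun m K v =>
  ⟨localUntwist hπ E hE σ₀ m K v, localUntwist_actsAsFrobPow hπ E hE σ₀ m K v, mapPt_localUntwist_cohPt hπ E hE σ₀ m K v⟩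

/-- THE INSTANCE k3-g40's `exists_untwisted_table` consumes (`hex m (m + 1 + k) v`): at Frobenius offset `k` over
level `m` the untwist acts on `𝒪_E` as `φ^{m+1+k}` — now hypothesis-free. -/
theorem localUntwistExists_offset (hE : E ≤ maxUnramified F) (σ₀ : absoluteGaloisGroup F) (m k : ℕ) (v : 𝒪[F]ˣ) :
    ∃ τ : (E ⊔ ltField π m : IntermediateField F (AlgebraicClosure F)) ≃ₐ[F]
        (E ⊔ ltField π m : IntermediateField F (AlgebraicClosure F)),
      ActsAsFrobPow E σ₀ (m + 1 + k) τ ∧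
        mapPt τ (inclPt (le_sup_right : ltField π m ≤ E ⊔ ltField π m) (cohPt hπ m)) =
          mapPt (relGalOfUnit hπ E m hE v) (inclPt (le_sup_right : ltField π m ≤ E ⊔ ltField π m) (cohPt hπ m)) :=
  localUntwistExists hπ E hE σ₀ m (m + 1 + k) v

/-! ## §4. UNIQUENESS (k3-g41 §5): the untwist is pinned by `φ^K` on `𝒪_E` and by its value on `ι ω_{m+1}` -/

omit [Normal F E] in
/-- An `F`-automorphism of `E·K_π^{m+1}` fixing `𝒪_E` pointwise fixes `E` pointwise (every `x ∈ E` lies in `𝒪_E`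
or is the inverse of an element of `𝒪_E`). -/
theorem forall_apply_inclusion_of_forall_unitBall {m : ℕ}
    {σ : (E ⊔ ltField π m : IntermediateField F (AlgebraicClosure F)) ≃ₐ[F]
      (E ⊔ ltField π m : IntermediateField F (AlgebraicClosure F))}
    (h : ∀ x : unitBall E, σ (IntermediateField.inclusion le_sup_left (x : E)) =
      IntermediateField.inclusion le_sup_left (x : E)) (x : E) :
    σ (IntermediateField.inclusion le_sup_left x) = IntermediateField.inclusion le_sup_left x := by
  by_cases hx : ‖x‖ ≤ 1
  · exact h ⟨x, (mem_unitBall_iff E).mpr hx⟩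
  · have hx1 : 1 < ‖x‖ := not_le.mp hx
    have hinv : ‖x⁻¹‖ ≤ 1 := by rw [norm_inv]; exact inv_le_one_of_one_le₀ hx1.le
    have h1 : σ (IntermediateField.inclusion le_sup_left x⁻¹) = IntermediateField.inclusion le_sup_left x⁻¹ :=
      h ⟨x⁻¹, (mem_unitBall_iff E).mpr hinv⟩
    rwa [map_inv₀, map_inv₀, inv_inj] at h1

/-- ★ **UNIQUENESS of the local untwist**: two automorphisms of `E·K_π^{m+1}` acting on `𝒪_E` as `φ^K` and agreeing
on `ι ω_{m+1}` are equal (`τ₁⁻¹τ₂` fixes `E` pointwise and the primitive point `[c_m]λ'`; tree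
`algEquiv_eq_of_mapPt_relAct_eq`).  So R217's `τ` is CANONICAL — row 110's `σ_loc`. -/
theorem localUntwist_unique (σ₀ : absoluteGaloisGroup F) {m K : ℕ}
    {τ₁ τ₂ : (E ⊔ ltField π m : IntermediateField F (AlgebraicClosure F)) ≃ₐ[F]
      (E ⊔ ltField π m : IntermediateField F (AlgebraicClosure F))}
    (h₁ : ActsAsFrobPow E σ₀ K τ₁) (h₂ : ActsAsFrobPow E σ₀ K τ₂)
    (hpt : mapPt τ₁ (inclPt (le_sup_right : ltField π m ≤ E ⊔ ltField π m) (cohPt hπ m)) =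
      mapPt τ₂ (inclPt (le_sup_right : ltField π m ≤ E ⊔ ltField π m) (cohPt hπ m))) :
    τ₁ = τ₂ := by
  rw [← inv_mul_eq_one]
  refine algEquiv_eq_of_mapPt_relAct_eq hπ E m (cohUnit hπ m) (fun x => ?_) (fun _ => rfl) ?_
  · refine forall_apply_inclusion_of_forall_unitBall E (fun y => ?_) x
    rw [AlgEquiv.mul_apply, h₂ y, ← h₁ y, AlgEquiv.aut_inv, AlgEquiv.symm_apply_apply]
  · rw [← inclPt_cohPt_eq_relAct, mapPt_mul, ← hpt, ← mapPt_mul, inv_mul_cancel]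

/-- ★ Every untwist IS `σ_loc(K, v)` (existence + uniqueness packaged). -/
theorem eq_localUntwist (hE : E ≤ maxUnramified F) (σ₀ : absoluteGaloisGroup F) {m K : ℕ} (v : 𝒪[F]ˣ)
    {τ : (E ⊔ ltField π m : IntermediateField F (AlgebraicClosure F)) ≃ₐ[F]
      (E ⊔ ltField π m : IntermediateField F (AlgebraicClosure F))}
    (hτ : ActsAsFrobPow E σ₀ K τ)
    (hpt : mapPt τ (inclPt (le_sup_right : ltField π m ≤ E ⊔ ltField π m) (cohPt hπ m)) =
      mapPt (relGalOfUnit hπ E m hE v) (inclPt (le_sup_right : ltField π m ≤ E ⊔ ltField π m) (cohPt hπ m))) :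
    τ = localUntwist hπ E hE σ₀ m K v :=
  localUntwist_unique hπ E σ₀ hτ (localUntwist_actsAsFrobPow hπ E hE σ₀ m K v)
    (by rw [hpt, mapPt_localUntwist_cohPt])

/-- `σ_loc` is a homomorphic image of `ℕ × 𝒪_F^×`: `σ_loc(K₁ + K₂, v₁v₂) = σ_loc(K₁, v₁) ∘ σ_loc(K₂, v₂)` — the Galois
form of `Gal(E·K_π^{m+1}/F) ⊇ ⟨φ⟩ × (𝒪_F/π^{m+1})^×` (de Shalit I §1.8, relative situation). -/
theorem localUntwist_add_mul (hE : E ≤ maxUnramified F) (σ₀ : absoluteGaloisGroup F) (m K₁ K₂ : ℕ) (v₁ v₂ : 𝒪[F]ˣ) :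
    localUntwist hπ E hE σ₀ m (K₁ + K₂) (v₁ * v₂) =
      localUntwist hπ E hE σ₀ m K₁ v₁ * localUntwist hπ E hE σ₀ m K₂ v₂ := by
  symm
  refine eq_localUntwist hπ E hE σ₀ (v₁ * v₂) (fun x => ?_) ?_
  · rw [AlgEquiv.mul_apply, localUntwist_actsAsFrobPow hπ E hE σ₀ m K₂ v₂ x,
      localUntwist_actsAsFrobPow hπ E hE σ₀ m K₁ v₁, ← Function.iterate_add_apply, Nat.add_comm]
  · rw [inclPt_cohPt_eq_relAct, mapPt_mul, mapPt_localUntwist_relAct, mapPt_localUntwist_relAct,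
      mapPt_relGalOfUnit_relAct, Units.val_mul, mul_assoc]

/-- `σ_v` acts on `𝒪_E` as `φ^0 = id`. -/
theorem actsAsFrobPow_zero_relGalOfUnit (hE : E ≤ maxUnramified F) (σ₀ : absoluteGaloisGroup F) (m : ℕ) (v : 𝒪[F]ˣ) :
    ActsAsFrobPow E σ₀ 0 (relGalOfUnit hπ E m hE v) :=
  fun x => relGalOfUnit_apply_inclusion hπ E m hE v (x : E)

/-- DEGENERATE INSTANCE (B68) `K = 0`: the untwist is `σ_v` itself (`χ_π(1) = 1`, no Frobenius to undo). -/
theorem localUntwist_zero (hE : E ≤ maxUnramified F) (σ₀ : absoluteGaloisGroup F) (m : ℕ) (v : 𝒪[F]ˣ) :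
    localUntwist hπ E hE σ₀ m 0 v = relGalOfUnit hπ E m hE v :=
  (eq_localUntwist hπ E hE σ₀ v (actsAsFrobPow_zero_relGalOfUnit hπ E hE σ₀ m v) rfl).symm

/-! ### Degenerate instance (B68): `E = ⊥`, i.e. the absolute tower `K_π^{m+1}/F` — nothing to untwist -/

omit [FiniteDimensional F E] [Normal F E] in
/-- On `𝒪_F = 𝒪_⊥` the Frobenius `φ = σ₀|` is the identity (every element is `F`-rational). -/
theorem frobUnitBall_iterate_bot (σ₀ : absoluteGaloisGroup F) (K : ℕ)
    (x : unitBall (⊥ : IntermediateField F (AlgebraicClosure F))) :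
    (((frobUnitBall (⊥ : IntermediateField F (AlgebraicClosure F)) σ₀ :
        unitBall (⊥ : IntermediateField F (AlgebraicClosure F)) ≃+*
          unitBall (⊥ : IntermediateField F (AlgebraicClosure F))) :
        unitBall (⊥ : IntermediateField F (AlgebraicClosure F)) →+*
          unitBall (⊥ : IntermediateField F (AlgebraicClosure F))) :
        unitBall (⊥ : IntermediateField F (AlgebraicClosure F)) →
          unitBall (⊥ : IntermediateField F (AlgebraicClosure F)))^[K] x = x := by
  apply Subtype.ext
  apply Subtype.ext
  rw [coe_frobUnitBall_iterate]
  obtain ⟨a, ha⟩ := IntermediateField.mem_bot.mp (x : (⊥ : IntermediateField F (AlgebraicClosure F))).2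
  rw [← ha, absoluteGaloisGroup.smul_def, AlgEquiv.commutes]

/-- `σ_v` acts on `𝒪_⊥` as `φ^K` for EVERY `K` (both are the identity there). -/
theorem actsAsFrobPow_bot (σ₀ : absoluteGaloisGroup F) (m K : ℕ) (v : 𝒪[F]ˣ) :
    ActsAsFrobPow (⊥ : IntermediateField F (AlgebraicClosure F)) σ₀ K
      (relGalOfUnit hπ (⊥ : IntermediateField F (AlgebraicClosure F)) m bot_le v) := fun x => by
  rw [frobUnitBall_iterate_bot]
  exact relGalOfUnit_apply_inclusion hπ (⊥ : IntermediateField F (AlgebraicClosure F)) m bot_le v _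

/-- ★ B68: over `F` itself (`E = ⊥`) the local untwist is `σ_v` for every exponent `K` — `σ₀` enters `σ_loc` only
through `σ₀|_E`. -/
theorem localUntwist_bot (σ₀ : absoluteGaloisGroup F) (m K : ℕ) (v : 𝒪[F]ˣ) :
    localUntwist hπ (⊥ : IntermediateField F (AlgebraicClosure F)) bot_le σ₀ m K v =
      relGalOfUnit hπ (⊥ : IntermediateField F (AlgebraicClosure F)) m bot_le v :=
  (eq_localUntwist hπ (⊥ : IntermediateField F (AlgebraicClosure F)) bot_le σ₀ v
    (actsAsFrobPow_bot hπ σ₀ m K v) rfl).symm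

/-! ## §5. VALUE HALF (k3-g40 §4): `evS` is Frobenius-semilinear, so the untwist reads the twisted tables -/

/-- Coefficients of an iterated coefficient map. -/
theorem coeff_map_iterate {A : Type*} [CommSemiring A] (ψ : A →+* A) (k : ℕ) (g : PowerSeries A) (n : ℕ) :
    PowerSeries.coeff n ((PowerSeries.map ψ)^[k] g) = ψ^[k] (PowerSeries.coeff n g) := by
  induction k generalizing g with
  | zero => rfl
  | succ k ih => rw [Function.iterate_succ_apply, ih, PowerSeries.coeff_map, ← Function.iterate_succ_apply ψ]


/-- ★ **S2, VALUE HALF (PROVED): the local untwist is semilinearity — for EVERY Frobenius offset `k`.**  If `g`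
interpolates `β` in the sense of `exists_relColeman` (`((φ⁻¹)^{m+1} g)^ι(ι ω_{m+1}) = β_m`) and `τ` acts on `𝒪_E` as
`φ^{m+1+k}`, then `(φ^k g)^ι(τ(ι ω_{m+1})) = τ(β_m)`: `k = 0` reads the level-`n+1` table of `g_b` itself (`Lg`),
`k = 1` the level-`n` table of `g_b^φ` (`Lφ`, the `½`-term of `log̃`), as Galois conjugates of table entries. -/
theorem evS_mapPt_eq_of_actsAsFrobPow (σ₀ : absoluteGaloisGroup F) (g : PowerSeries (unitBall E)) (m k : ℕ)
    (β : unitBall (E ⊔ ltField π m : IntermediateField F (AlgebraicClosure F)))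
    (hg : evS (maxNilIdeal F (E ⊔ ltField π m : IntermediateField F (AlgebraicClosure F)))
        (inclPt (le_sup_right : ltField π m ≤ E ⊔ ltField π m) (cohPt hπ m))
        (PowerSeries.map (inclUnitBall (F := F) (le_sup_left : E ≤ E ⊔ ltField π m) :
          unitBall E →+* unitBall (E ⊔ ltField π m : IntermediateField F (AlgebraicClosure F)))
          ((PowerSeries.map ((frobUnitBall E σ₀).symm : unitBall E →+* unitBall E))^[m + 1] g)) = β)
    (τ : (E ⊔ ltField π m : IntermediateField F (AlgebraicClosure F)) ≃ₐ[F]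
      (E ⊔ ltField π m : IntermediateField F (AlgebraicClosure F)))
    (hτ : ActsAsFrobPow E σ₀ (m + 1 + k) τ) :
    ((evS (maxNilIdeal F (E ⊔ ltField π m : IntermediateField F (AlgebraicClosure F)))
        (mapPt τ (inclPt (le_sup_right : ltField π m ≤ E ⊔ ltField π m) (cohPt hπ m)))
        (PowerSeries.map (inclUnitBall (F := F) (le_sup_left : E ≤ E ⊔ ltField π m) :
          unitBall E →+* unitBall (E ⊔ ltField π m : IntermediateField F (AlgebraicClosure F)))
          ((PowerSeries.map (frobUnitBall E σ₀ : unitBall E →+* unitBall E))^[k] g)) :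
        unitBall (E ⊔ ltField π m : IntermediateField F (AlgebraicClosure F))) :
        (E ⊔ ltField π m : IntermediateField F (AlgebraicClosure F))) =
      τ ((β : unitBall (E ⊔ ltField π m : IntermediateField F (AlgebraicClosure F))) :
        (E ⊔ ltField π m : IntermediateField F (AlgebraicClosure F))) := by
  -- the coefficient computation: `τ ∘ ι ∘ (φ⁻¹)^{m+1} = ι ∘ φ^k` on the coefficients of `g`
  have hfix : PowerSeries.map (toUnitBallHom τ : unitBall (E ⊔ ltField π m : IntermediateField F (AlgebraicClosure F)) →+*
        unitBall (E ⊔ ltField π m : IntermediateField F (AlgebraicClosure F)))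
      (PowerSeries.map (inclUnitBall (F := F) (le_sup_left : E ≤ E ⊔ ltField π m) :
          unitBall E →+* unitBall (E ⊔ ltField π m : IntermediateField F (AlgebraicClosure F)))
        ((PowerSeries.map ((frobUnitBall E σ₀).symm : unitBall E →+* unitBall E))^[m + 1] g)) =
      PowerSeries.map (inclUnitBall (F := F) (le_sup_left : E ≤ E ⊔ ltField π m) :
          unitBall E →+* unitBall (E ⊔ ltField π m : IntermediateField F (AlgebraicClosure F)))
        ((PowerSeries.map (frobUnitBall E σ₀ : unitBall E →+* unitBall E))^[k] g) := by
    refine PowerSeries.ext fun n => ?_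
    rw [PowerSeries.coeff_map, PowerSeries.coeff_map, PowerSeries.coeff_map, coeff_map_iterate, coeff_map_iterate]
    refine Subtype.ext ?_
    have hcancel : ∀ c : unitBall E,
        (((frobUnitBall E σ₀ : unitBall E ≃+* unitBall E) : unitBall E →+* unitBall E) :
            unitBall E → unitBall E)^[m + 1]
          (((((frobUnitBall E σ₀).symm : unitBall E ≃+* unitBall E) : unitBall E →+* unitBall E) :
            unitBall E → unitBall E)^[m + 1] c) = c :=
      Function.LeftInverse.iterate
        (g := (((frobUnitBall E σ₀ : unitBall E ≃+* unitBall E) : unitBall E →+* unitBall E) :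
            unitBall E → unitBall E))
        (f := ((((frobUnitBall E σ₀).symm : unitBall E ≃+* unitBall E) : unitBall E →+* unitBall E) :
            unitBall E → unitBall E))
        (fun x => by simp) (m + 1)
    have h1 := hτ (((((frobUnitBall E σ₀).symm : unitBall E ≃+* unitBall E) : unitBall E →+* unitBall E) :
            unitBall E → unitBall E)^[m + 1] (PowerSeries.coeff n g))
    rw [show m + 1 + k = k + (m + 1) from Nat.add_comm _ _] at h1
    rw [Function.iterate_add_apply _ k (m + 1), hcancel] at h1
    exact h1
  have key := algEquiv_evS (E ⊔ ltField π m : IntermediateField F (AlgebraicClosure F)) τ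
    (PowerSeries.map (inclUnitBall (F := F) (le_sup_left : E ≤ E ⊔ ltField π m) :
        unitBall E →+* unitBall (E ⊔ ltField π m : IntermediateField F (AlgebraicClosure F)))
      ((PowerSeries.map ((frobUnitBall E σ₀).symm : unitBall E →+* unitBall E))^[m + 1] g))
    (inclPt (le_sup_right : ltField π m ≤ E ⊔ ltField π m) (cohPt hπ m))
  rw [hfix, hg] at key
  rw [← key, coe_toUnitBallHom]

/-- ★ **S2 assembled: the UNTWISTED VALUE TABLES (hypothesis-free, critic J4).**  For every unit `v` and offset `k` the
value of `φ^k g` at the primitive point `σ_v(ι ω_{m+1})` is a Galois conjugate `τ(β_m)` with `τ|_{𝒪_E} = φ^{m+1+k}` —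
the tables `Lg` (`k = 0`, level `n+1`) and `Lφ` (`k = 1`, level `n`) of §1, whose `plog ∘ θ` the seam
(`LogDerivSeam`, k3-g38; RCF) turns into `log σ_γ(b)`-tables. -/
theorem exists_untwisted_table (hE : E ≤ maxUnramified F) (σ₀ : absoluteGaloisGroup F)
    (g : PowerSeries (unitBall E)) (m k : ℕ)
    (β : unitBall (E ⊔ ltField π m : IntermediateField F (AlgebraicClosure F)))
    (hg : evS (maxNilIdeal F (E ⊔ ltField π m : IntermediateField F (AlgebraicClosure F)))
        (inclPt (le_sup_right : ltField π m ≤ E ⊔ ltField π m) (cohPt hπ m))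
        (PowerSeries.map (inclUnitBall (F := F) (le_sup_left : E ≤ E ⊔ ltField π m) :
          unitBall E →+* unitBall (E ⊔ ltField π m : IntermediateField F (AlgebraicClosure F)))
          ((PowerSeries.map ((frobUnitBall E σ₀).symm : unitBall E →+* unitBall E))^[m + 1] g)) = β)
    (v : 𝒪[F]ˣ) :
    ∃ τ : (E ⊔ ltField π m : IntermediateField F (AlgebraicClosure F)) ≃ₐ[F]
        (E ⊔ ltField π m : IntermediateField F (AlgebraicClosure F)),
      ActsAsFrobPow E σ₀ (m + 1 + k) τ ∧
      ((evS (maxNilIdeal F (E ⊔ ltField π m : IntermediateField F (AlgebraicClosure F)))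
          (mapPt (relGalOfUnit hπ E m hE v) (inclPt (le_sup_right : ltField π m ≤ E ⊔ ltField π m) (cohPt hπ m)))
          (PowerSeries.map (inclUnitBall (F := F) (le_sup_left : E ≤ E ⊔ ltField π m) :
            unitBall E →+* unitBall (E ⊔ ltField π m : IntermediateField F (AlgebraicClosure F)))
            ((PowerSeries.map (frobUnitBall E σ₀ : unitBall E →+* unitBall E))^[k] g)) :
          unitBall (E ⊔ ltField π m : IntermediateField F (AlgebraicClosure F))) :
          (E ⊔ ltField π m : IntermediateField F (AlgebraicClosure F))) =
        τ ((β : unitBall (E ⊔ ltField π m : IntermediateField F (AlgebraicClosure F))) :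
          (E ⊔ ltField π m : IntermediateField F (AlgebraicClosure F))) := by
  obtain ⟨τ, hτ, hpt⟩ := localUntwistExists hπ E hE σ₀ m (m + 1 + k) v
  exact ⟨τ, hτ, by rw [← hpt]; exact evS_mapPt_eq_of_actsAsFrobPow hπ E σ₀ g m k β hg τ hτ⟩

/-- ★ (critic J5, sharper than `exists_untwisted_table`): the untwist may be taken to be THE EXPLICIT `σ_loc(m+1+k, v) = localUntwist (m+1+k) v`
— R219-INST₂ computes with a named automorphism. -/
theorem untwisted_table_explicit (hE : E ≤ maxUnramified F) (σ₀ : absoluteGaloisGroup F)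
    (g : PowerSeries (unitBall E)) (m k : ℕ)
    (β : unitBall (E ⊔ ltField π m : IntermediateField F (AlgebraicClosure F)))
    (hg : evS (maxNilIdeal F (E ⊔ ltField π m : IntermediateField F (AlgebraicClosure F)))
        (inclPt (le_sup_right : ltField π m ≤ E ⊔ ltField π m) (cohPt hπ m))
        (PowerSeries.map (inclUnitBall (F := F) (le_sup_left : E ≤ E ⊔ ltField π m) :
          unitBall E →+* unitBall (E ⊔ ltField π m : IntermediateField F (AlgebraicClosure F)))
          ((PowerSeries.map ((frobUnitBall E σ₀).symm : unitBall E →+* unitBall E))^[m + 1] g)) = β)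
    (v : 𝒪[F]ˣ) :
    ((evS (maxNilIdeal F (E ⊔ ltField π m : IntermediateField F (AlgebraicClosure F)))
        (mapPt (relGalOfUnit hπ E m hE v) (inclPt (le_sup_right : ltField π m ≤ E ⊔ ltField π m) (cohPt hπ m)))
        (PowerSeries.map (inclUnitBall (F := F) (le_sup_left : E ≤ E ⊔ ltField π m) :
          unitBall E →+* unitBall (E ⊔ ltField π m : IntermediateField F (AlgebraicClosure F)))
          ((PowerSeries.map (frobUnitBall E σ₀ : unitBall E →+* unitBall E))^[k] g)) :
        unitBall (E ⊔ ltField π m : IntermediateField F (AlgebraicClosure F))) :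
        (E ⊔ ltField π m : IntermediateField F (AlgebraicClosure F))) =
      localUntwist hπ E hE σ₀ m (m + 1 + k) v
        ((β : unitBall (E ⊔ ltField π m : IntermediateField F (AlgebraicClosure F))) :
          (E ⊔ ltField π m : IntermediateField F (AlgebraicClosure F))) := by
  rw [← mapPt_localUntwist_cohPt hπ E hE σ₀ m (m + 1 + k) v]
  exact evS_mapPt_eq_of_actsAsFrobPow hπ E σ₀ g m k β hg _ (localUntwist_actsAsFrobPow hπ E hE σ₀ m (m + 1 + k) v)

end Summit.BirchSwinnertonDyer.Rank1Residual.P2.LocalUntwist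

end
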